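import Summits.QuantumFields.BalabanUV.Beta.GAN24.FibreUniformBoundOfParts
import Summits.QuantumFields.BalabanUV.Beta.GAN24.ForceSourceFeedback

/-!
# `BalabanUV.Beta.GAN24.ScaledPartMF` — binder row G-an2-4 / (CONV-C), road P1-fibre, typer row **L09-H3** (node N14-H3 of
# `GAN24/Formal/LEAVES.md` v2.7 § II.A2; leaf-05-g6's cut of p1 row L09 `FibreUniformBound`, CLAIMS l.3028/l.3053): THE MULTIPLIER–FIELD
# SCALED PART `ScaledMF (d := 3) Lc (sfStep Lc) (smStep 3 Lc) K₃` — DISCHARGED with the explicit `K₃ = bPhi0 4 Lc (4π²) / Lc⁵`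

NOT IN PRINT; OUR PROOF ATTEMPT.  HONEST FRAMING (cell contract, verbatim): «discharging `BetaPertH` makes Bałaban's UV stability
UNCONDITIONAL — a real constructive-QFT result; it is NOT the continuum limit and NOT the Clay problem.»  HONEST DEPENDENCY (verbatim):
«continuum YM on T⁴ ⇐ BetaPertH ∧ nine spine estimates (0/9 proved); BetaPertH ⇐ (D1) ∧ (D4) ∧ CAP+tail; G-an2-4 gates asym, D1 and
NE2/3/4.»  [folklore] bookkeeping (units × a landed bound); NO cited fact, NO `def … : Prop` hypothesis, NO wall binder, NO new object.
NOT summit progress; nothing of (CONV-C)'s K-slot is discharged here — this is ONE of the four scaled parts H1–H4 of the real-zone bound L09.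

## What is proved (`d = 3`, `D = 4`, `N = Lc^{j+1}`, `M = Lc^j`, `p = ofRealVec q`, `q ∈ BZ 4 ∖ {0}`)
leaf-03-g6's (A) `ForceSourceFeedback.norm_phiSol_fhatF_le'` gives `‖φ[f̂ = fhatF N M p l y′, ĉ = 0]_κ‖ ≤ bPhi0 D (N/M) (D·π²) / N^{D+1}`
for every `D` (the `|q|`-powers of L08 `CapacitanceEndpoint.norm_phiSol_le` are EXACTLY cancelled by the `|q|`-multiplied source sums of
`ForceSourceBounds`, and `|q|² ≤ Dπ²`).  The adopted units give `sfStep Lc j · smStep 3 Lc j = (Lc^j)^5 = M⁵` (`ReadingWeightSums.sfStep_mul_smStep`)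
and `N^5 = M^5·Lc^5`, `N/M = Lc`, so the product is `≤ bPhi0 4 Lc (4π²) / Lc⁵` — `N`-FREE (this is the one scaled part whose units close for
EVERY `D`: `M^{D+1}/N^{D+1} = Lc^{−(D+1)}`).
* `cast_pow_succ_div` (`↑(Lc^{j+1}) / ↑(Lc^j) = Lc`), `units_MF` (`sfStep·smStep 3 / N⁵ = 1/Lc⁵`);
* **`scaledMF_bound`** — the unfolded statement with `K₃ = bPhi0 4 Lc (4π²) / Lc⁵` (written out, no new definition; `kMF_nonneg`);
* **`scaledMF_step : ScaledMF (d := 3) Lc (sfStep Lc) (smStep 3 Lc) (bPhi0 4 Lc (4π²) / Lc⁵)`** — EXACTLY the shape leaf-05-g6's assembly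
  `FibreUniformBound.fibreUniformBound_step_of_scaled` consumes as `h₃`; `scaledMF_step_of_le` (any larger `K`).
Unit `b2b-balaban-gan24-formalise-leaf-18` (G-an2-4 formalisation swarm), 2026-08-20.
-/

noncomputable section

open Complex Finset
open scoped BigOperators Real
open Literature.Probability.LatticeModels (TorusSite)
open Literature.MathematicalPhysics.QuantumFieldTheory.Balaban1983to89.B4Strip (ofRealVec)
open Literature.MathematicalPhysics.QuantumFieldTheory.Balaban1983to89.B4ContourShift (BZ)
open Literature.MathematicalPhysics.QuantumFieldTheory.King1986 (momSq)
open Summit.QuantumFields.BalabanUV.Beta.GAN24.CombesThomas (sfStep smStep)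
open Summit.QuantumFields.BalabanUV.Beta.GAN24.AliasObjects (phiSol fhatF)
open Summit.QuantumFields.BalabanUV.Beta.GAN24.ReadingWeightSums (sfStep_mul_smStep)
open Summit.QuantumFields.BalabanUV.Beta.GAN24.FibreUniformBound (ScaledMF)
open Summit.QuantumFields.BalabanUV.Beta.GAN24.ForceSourceFeedback (bPhi0 bPhi0_nonneg norm_phiSol_fhatF_le')

namespace Summit.QuantumFields.BalabanUV.Beta.GAN24.ScaledPartMF

/-- [folklore] The explicit H3 constant `K₃(Lc) = bPhi0 4 Lc (4π²) / Lc⁵` is nonnegative (no new definition: the constant is written out, so that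
leaf-05-g6's assembly can merge H1–H4 under one `K` by `max`/sum). -/
theorem kMF_nonneg (Lc : ℕ) : 0 ≤ bPhi0 4 (Lc : ℝ) (4 * π ^ 2) / (Lc : ℝ) ^ 5 :=
  div_nonneg (bPhi0_nonneg 4 (Nat.cast_nonneg Lc) (by positivity)) (by positivity)

/-- [folklore] The ratio of consecutive block sides is `Lc`: `↑(Lc^{j+1}) / ↑(Lc^j) = Lc` (as reals; `Lc ≠ 0`). -/
theorem cast_pow_succ_div (Lc : ℕ) [NeZero Lc] (j : ℕ) : (((Lc ^ (j + 1) : ℕ) : ℝ)) / (((Lc ^ j : ℕ) : ℝ)) = (Lc : ℝ) := by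
  have hLc : (Lc : ℝ) ≠ 0 := Nat.cast_ne_zero.2 (NeZero.ne Lc)
  push_cast
  rw [pow_succ, mul_div_cancel_left₀ (Lc : ℝ) (pow_ne_zero _ hLc)]

/-- [folklore] THE UNIT COUNT of the multiplier–field part at `d = 3`: `sfStep Lc j · smStep 3 Lc j / N⁵ = 1/Lc⁵` (`= M⁵/N⁵`, `N = M·Lc`). -/
theorem units_MF (Lc : ℕ) [NeZero Lc] (j : ℕ) :
    sfStep Lc j * smStep 3 Lc j / (((Lc ^ (j + 1) : ℕ) : ℝ)) ^ (3 + 1 + 1) = 1 / (Lc : ℝ) ^ 5 := by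
  have hLc : (Lc : ℝ) ≠ 0 := Nat.cast_ne_zero.2 (NeZero.ne Lc)
  rw [sfStep_mul_smStep]
  push_cast
  rw [div_eq_div_iff (pow_ne_zero _ (pow_ne_zero _ hLc)) (pow_ne_zero _ hLc), one_mul, ← pow_mul, ← pow_mul, ← pow_add]
  congr 1
  ring

/-- [folklore] **H3, UNFOLDED**: for every step `j`, every `q ∈ BZ 4 ∖ {0}` and all `κ l y′`,
`sfStep Lc j · smStep 3 Lc j · ‖phiSol (Lc^{j+1}) (ofRealVec q) (fhatF (Lc^{j+1}) (Lc^j) (ofRealVec q) l y′) 0 κ‖ ≤ K₃(Lc)`. -/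
theorem scaledMF_bound (Lc : ℕ) [NeZero Lc] (j : ℕ) {q : Fin (3 + 1) → ℝ} (hq : q ∈ BZ (3 + 1)) (hq0 : q ≠ 0)
    (κ l : Fin (3 + 1)) (y' : Fin (3 + 1) → ℤ) :
    sfStep Lc j * smStep 3 Lc j * ‖phiSol (Lc ^ (j + 1)) (ofRealVec q) (fhatF (Lc ^ (j + 1)) (Lc ^ j) (ofRealVec q) l y') 0 κ‖
      ≤ bPhi0 4 (Lc : ℝ) (4 * π ^ 2) / (Lc : ℝ) ^ 5 := by
  have hqi : ∀ i, |q i| ≤ π := fun i => abs_le.mpr ⟨hq.1 i, hq.2 i⟩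
  have hLcpos : 0 < Lc := Nat.pos_of_ne_zero (NeZero.ne Lc)
  have hN : 1 ≤ Lc ^ (j + 1) := Nat.one_le_pow _ _ hLcpos
  have hM : 0 < Lc ^ j := pow_pos hLcpos j
  have hMN : Lc ^ j ≤ Lc ^ (j + 1) := Nat.pow_le_pow_right hLcpos (Nat.le_succ j)
  have h := norm_phiSol_fhatF_le' (N := Lc ^ (j + 1)) hN hM hMN hqi hq0 l y' κ
  rw [cast_pow_succ_div] at h
  have hunits : 0 ≤ sfStep Lc j * smStep 3 Lc j := by
    rw [sfStep_mul_smStep]; positivity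
  have hb : 0 ≤ bPhi0 (3 + 1) (Lc : ℝ) (((3 + 1 : ℕ) : ℝ) * π ^ 2) := bPhi0_nonneg _ (Nat.cast_nonneg Lc) (by positivity)
  calc sfStep Lc j * smStep 3 Lc j * ‖phiSol (Lc ^ (j + 1)) (ofRealVec q) (fhatF (Lc ^ (j + 1)) (Lc ^ j) (ofRealVec q) l y') 0 κ‖
      ≤ sfStep Lc j * smStep 3 Lc j * (bPhi0 (3 + 1) (Lc : ℝ) (((3 + 1 : ℕ) : ℝ) * π ^ 2) / (((Lc ^ (j + 1) : ℕ) : ℝ)) ^ (3 + 1 + 1)) :=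
        mul_le_mul_of_nonneg_left h hunits
    _ = bPhi0 (3 + 1) (Lc : ℝ) (((3 + 1 : ℕ) : ℝ) * π ^ 2) * (sfStep Lc j * smStep 3 Lc j / (((Lc ^ (j + 1) : ℕ) : ℝ)) ^ (3 + 1 + 1)) := by
        ring
    _ = bPhi0 (3 + 1) (Lc : ℝ) (((3 + 1 : ℕ) : ℝ) * π ^ 2) * (1 / (Lc : ℝ) ^ 5) := by rw [units_MF]
    _ = bPhi0 4 (Lc : ℝ) (4 * π ^ 2) / (Lc : ℝ) ^ 5 := by
        norm_num
        ring

/-- [folklore] **H3 DISCHARGED**: `ScaledMF (d := 3) Lc (sfStep Lc) (smStep 3 Lc) (K₃ Lc)` — EXACTLY the hypothesis `h₃` of leaf-05-g6's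
`FibreUniformBound.fibreUniformBound_step_of_scaled` at `d = 3`. -/
theorem scaledMF_step (Lc : ℕ) [NeZero Lc] :
    ScaledMF (d := 3) Lc (sfStep Lc) (smStep 3 Lc) (bPhi0 4 (Lc : ℝ) (4 * π ^ 2) / (Lc : ℝ) ^ 5) := by
  intro j q hq hq0 κ l y'
  exact scaledMF_bound Lc j hq hq0 κ l y'

/-- [folklore] The same with ANY larger constant (e.g. to merge H1–H4 under one `K`). -/
theorem scaledMF_step_of_le (Lc : ℕ) [NeZero Lc] {K : ℝ} (hK : bPhi0 4 (Lc : ℝ) (4 * π ^ 2) / (Lc : ℝ) ^ 5 ≤ K) :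
    ScaledMF (d := 3) Lc (sfStep Lc) (smStep 3 Lc) K := by
  intro j q hq hq0 κ l y'
  exact (scaledMF_bound Lc j hq hq0 κ l y').trans hK

end Summit.QuantumFields.BalabanUV.Beta.GAN24.ScaledPartMF

end
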